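import Literature.AnabelianGeometry.SemiGraphs.TemperedEstrangedElevatedConstructors
import Literature.AnabelianGeometry.SemiGraphs.ThetaRayGraph
import HarnessLib

/-!
# (H3) for the ray of groups `𝒢_θ`: totally estranged and totally aloof, in binder form

S. Mochizuki, *Semi-graphs of anabelioids*, Publ. RIMS **42** (2006), Def. 2.4 (iv) p. 26 («aloof»,
«estranged») for the semi-graph of anabelioids `𝒢_θ = thetaRay G E up low` of `ThetaRayGraph.lean` (brick R3,
abc-iut-w6-d070): the ray `v_0 — v_1 — v_2 — ⋯`, all vertex groups `G`, all edge groups `E`, the branch `β_k⁺` of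
`e_k` glued into `G_{v_{k+1}}` by `up` and the branch `β_k⁻` glued into `G_{v_k}` by `low k`.

At the vertex `v_{k+1}` the two branch subgroups are `range up` (from `e_k`) and `range (low (k+1))` (from
`e_{k+1}`); at `v_0` only `range (low 0)`.  Hence (file-local case analysis on the four branch pairs, then the
generic constructor `isTotallyEstranged_and_isTotallyAloof_of_forall_inf_conj_eq_bot` of
`TemperedEstrangedElevatedConstructors.lean`):

* `thetaRay_isTotallyEstranged_and_isTotallyAloof` — BINDER FORM: infinitude and malnormality of `range up`,
  `range (low k)` and the CROSS estrangement `range up ∩ g·range (low (k+1))·g⁻¹ = 1` for all `g` give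
  `IsTotallyEstranged ∧ IsTotallyAloof`;
* `thetaRay_isTotallyEstranged_and_isTotallyAloof_of_topologicalClosure` — the same with the hypotheses in
  the «closed procyclic subgroup» spelling `closure ⟨up e⟩`, `closure ⟨low k e⟩`, `ConjAct`-conjugates (`E`
  topologically generated by `e`), i.e. VERBATIM the outputs of bricks R2a (`FreeProPTwoSlimMalnormal`:
  `closure_zpowers_a_inf_conj_eq_bot`, `closure_zpowers_aMulPow_inf_conj_eq_bot'`, `infinite_closure_zpowers_*`)
  and R2b (`FreeProPTwoEstrangementByAbelianisation`: `inf_conj_topologicalClosure_zpowers_mul_pow_prime_pow_eq_bot`);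
  and the `thetaRayOfTwists` forms.

Cell context (abc-iut, layer L3, FRONTIER programme SUBDAG-REFUTE-F1732, brick R5 (H3), seat abc-iut-w6-d102):
these are the binders `hTA` / `hTEs` of `thetaRay_thm37Hypotheses` (`ThetaRayGraphHypotheses.lean`) — towards a
kernel erratum for the ∀-countable reading of [SemiAnbd] Thm 3.7 (iii) ([IUTchI] Rmk 2.5.3); desk countermodel
abc-iut-L3-d1 g3 (memo 8b26b5199c29f55f); print proves finite `𝔾` (kernel: p431007).  PROOF-ONLY, no
definition, no named fact; nothing here bears on [IUTchIII] Cor. 3.12; typed ≠ proved.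
[cite: MochizukiSemiAnbd2006, Def 2.4(iv) p.26]
-/

noncomputable section

namespace Literature.AnabelianGeometry.SemiGraphs

namespace ProfiniteSemiGraph

open scoped Pointwise
open Topology

section H3

variable {G E : Type} [Group G] [TopologicalSpace G] [IsTopologicalGroup G] [CompactSpace G]
  [TotallyDisconnectedSpace G] [Group E] [TopologicalSpace E] [IsTopologicalGroup E] [CompactSpace E]
  [TotallyDisconnectedSpace E] (α : E →ₜ* G) (β : ℕ → (E →ₜ* G))

/-- The vertex a branch `(k, s)` of the ray abuts to (`true` = `β_k⁺ → v_{k+1}`, `false` = `β_k⁻ → v_k`).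
[cite: MochizukiSemiAnbd2006, §1 p.11] -/
theorem thetaRay_abuts_eq_some_iff (b : ℕ × Bool) (v : ℕ) :
    SemiGraph.ray.abuts b = some v ↔ (if b.2 then b.1 + 1 else b.1) = v := by
  constructor
  · intro h; exact Option.some.inj h
  · intro h; exact congrArg some h

/-- Branch subgroups of `𝒢_θ` in closed form: `range up` at upper ends, `range (low k)` at lower ends.
[cite: MochizukiSemiAnbd2006, §2 p.23] -/
theorem thetaRay_branchSubgroup_eq (b : ℕ × Bool) (v : ℕ) (h : SemiGraph.ray.abuts b = some v) :
    (thetaRay G E α β).branchSubgroup b v h =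
      (if b.2 then α.toMonoidHom.range else (β b.1).toMonoidHom.range) := by
  obtain ⟨k, s⟩ := b
  cases s <;> rfl

/-- **(H3) in binder form**: infinitude + malnormality of `range α`, `range (β k)` and the cross
estrangement `range α ∩ g · range (β (k+1)) · g⁻¹ = 1` (at `v_{k+1}`) give total estrangement and total
aloofness of the ray of groups. [cite: MochizukiSemiAnbd2006, Def 2.4(iv) p.26] -/
theorem thetaRay_isTotallyEstranged_and_isTotallyAloof
    (hα_inf : (α.toMonoidHom.range : Set G).Infinite)
    (hβ_inf : ∀ k, ((β k).toMonoidHom.range : Set G).Infinite)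
    (hα_mal : ∀ g : G, g ∉ α.toMonoidHom.range →
      α.toMonoidHom.range ⊓ α.toMonoidHom.range.map (MulAut.conj g).toMonoidHom = ⊥)
    (hβ_mal : ∀ (k : ℕ) (g : G), g ∉ (β k).toMonoidHom.range →
      (β k).toMonoidHom.range ⊓ (β k).toMonoidHom.range.map (MulAut.conj g).toMonoidHom = ⊥)
    (hcross : ∀ (k : ℕ) (g : G),
      α.toMonoidHom.range ⊓ (β (k + 1)).toMonoidHom.range.map (MulAut.conj g).toMonoidHom = ⊥) :
    (thetaRay G E α β).IsTotallyEstranged ∧ (thetaRay G E α β).IsTotallyAloof := by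
  refine (thetaRay G E α β).isTotallyEstranged_and_isTotallyAloof_of_forall_inf_conj_eq_bot ?_ ?_
  · rintro ⟨k, s⟩ v h
    rw [thetaRay_branchSubgroup_eq]
    cases s
    · exact hβ_inf k
    · exact hα_inf
  · rintro v ⟨k, s⟩ h ⟨k', s'⟩ h' g hg
    rw [thetaRay_branchSubgroup_eq] at hg ⊢
    rw [thetaRay_branchSubgroup_eq]
    have hv := (thetaRay_abuts_eq_some_iff _ _).mp h
    have hv' := (thetaRay_abuts_eq_some_iff _ _).mp h'
    cases s <;> cases s' <;> simp only [Bool.false_eq_true, ↓reduceIte] at hv hv' hg ⊢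
    · -- lower / lower at `v = k = k'`: same branch, malnormality of `range (β k)`
      subst hv; subst hv'
      rcases hg with hne | hg
      · exact absurd rfl hne
      · exact hβ_mal k' g hg
    · -- b lower at v = k, b' upper at v = k'+1: k = k'+1, cross term (symmetric form)
      subst hv
      have hk : k = k' + 1 := hv'.symm
      subst hk
      exact inf_map_conj_eq_bot_symm' (hcross k') g
    · -- b upper at v = k+1, b' lower at v = k': k' = k+1, cross term
      subst hv
      have hk : k' = k + 1 := hv'
      subst hk
      exact hcross k g
    · -- upper / upper at `v = k+1 = k'+1`: same branch, malnormality of `range α`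
      subst hv
      have hk : k' = k := by omega
      subst hk
      rcases hg with hne | hg
      · exact absurd rfl hne
      · exact hα_mal g hg
where
  /-- file-local copy of the symmetry bridge `inf_map_conj_eq_bot_symm`. [cite: MochizukiSemiAnbd2006, Def 2.4(iv) p.26] -/
  inf_map_conj_eq_bot_symm' {A B : Subgroup G}
      (h : ∀ g : G, A ⊓ B.map (MulAut.conj g).toMonoidHom = ⊥) (g : G) :
      B ⊓ A.map (MulAut.conj g).toMonoidHom = ⊥ := by
    rw [eq_bot_iff]
    rintro x ⟨hxB, ⟨y, hyA, rfl⟩⟩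
    rw [Subgroup.mem_bot]
    have hy : y ∈ A ⊓ B.map (MulAut.conj g⁻¹).toMonoidHom := by
      refine ⟨hyA, ⟨(MulAut.conj g).toMonoidHom y, hxB, ?_⟩⟩
      show g⁻¹ * (g * y * g⁻¹) * g⁻¹⁻¹ = y
      simp [mul_assoc]
    rw [h g⁻¹, Subgroup.mem_bot] at hy
    show g * y * g⁻¹ = 1
    rw [hy, mul_one, mul_inv_cancel]

end H3

/-! ### The same in the «closed procyclic subgroup» spelling of bricks R2a / R2b -/

section Closure

variable {G E : Type} [Group G] [TopologicalSpace G] [IsTopologicalGroup G] [CompactSpace G]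
  [TotallyDisconnectedSpace G] [T2Space G] [Group E] [TopologicalSpace E] [IsTopologicalGroup E]
  [CompactSpace E] [TotallyDisconnectedSpace E] (α : E →ₜ* G) (β : ℕ → (E →ₜ* G))

/-- **(H3) from the R2a/R2b outputs**: with `E` topologically generated by `e` (e.g. `E = ℤ_p`, `e = 1`), the
branch subgroups of `𝒢_θ` are `closure ⟨up e⟩` and `closure ⟨low k e⟩`
(`range_eq_topologicalClosure_zpowers`); infinitude, malnormality (`x ∉ C ⇒ C ∩ x C x⁻¹ = 1`) and the cross
estrangement `closure ⟨up e⟩ ∩ g • closure ⟨low (k+1) e⟩ = 1` in that spelling give total estrangement and total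
aloofness. [cite: MochizukiSemiAnbd2006, Def 2.4(iv) p.26] -/
theorem thetaRay_isTotallyEstranged_and_isTotallyAloof_of_topologicalClosure (e : E)
    (he : (Subgroup.zpowers e).topologicalClosure = ⊤)
    (hA_inf : Infinite (Subgroup.zpowers (α e)).topologicalClosure)
    (hB_inf : ∀ k, Infinite (Subgroup.zpowers (β k e)).topologicalClosure)
    (hA_mal : ∀ x : G, x ∉ (Subgroup.zpowers (α e)).topologicalClosure →
      (Subgroup.zpowers (α e)).topologicalClosure ⊓
        ConjAct.toConjAct x • (Subgroup.zpowers (α e)).topologicalClosure = ⊥)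
    (hB_mal : ∀ (k : ℕ) (x : G), x ∉ (Subgroup.zpowers (β k e)).topologicalClosure →
      (Subgroup.zpowers (β k e)).topologicalClosure ⊓
        ConjAct.toConjAct x • (Subgroup.zpowers (β k e)).topologicalClosure = ⊥)
    (hcross : ∀ (k : ℕ) (g : ConjAct G),
      (Subgroup.zpowers (α e)).topologicalClosure ⊓
        g • (Subgroup.zpowers (β (k + 1) e)).topologicalClosure = ⊥) :
    (thetaRay G E α β).IsTotallyEstranged ∧ (thetaRay G E α β).IsTotallyAloof := by
  have hrα : α.toMonoidHom.range = (Subgroup.zpowers (α e)).topologicalClosure :=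
    range_eq_topologicalClosure_zpowers α e he
  have hrβ : ∀ k, (β k).toMonoidHom.range = (Subgroup.zpowers (β k e)).topologicalClosure := fun k =>
    range_eq_topologicalClosure_zpowers (β k) e he
  refine thetaRay_isTotallyEstranged_and_isTotallyAloof α β ?_ ?_ ?_ ?_ ?_
  · rw [hrα]; exact Set.infinite_coe_iff.mp hA_inf
  · intro k; rw [hrβ]; exact Set.infinite_coe_iff.mp (hB_inf k)
  · intro g hg
    rw [hrα] at hg ⊢
    rw [map_conj_eq_toConjAct_smul]
    exact hA_mal g hg
  · intro k g hg
    rw [hrβ] at hg ⊢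
    rw [map_conj_eq_toConjAct_smul]
    exact hB_mal k g hg
  · intro k g
    rw [hrα, hrβ, map_conj_eq_toConjAct_smul]
    exact hcross k (ConjAct.toConjAct g)

/-- The `IsTotallyEstranged` half (binder `hTEs` of `thetaRay_thm37Hypotheses`).
[cite: MochizukiSemiAnbd2006, Def 2.4(iv) p.26] -/
theorem thetaRay_isTotallyEstranged_of_topologicalClosure (e : E)
    (he : (Subgroup.zpowers e).topologicalClosure = ⊤)
    (hA_inf : Infinite (Subgroup.zpowers (α e)).topologicalClosure)
    (hB_inf : ∀ k, Infinite (Subgroup.zpowers (β k e)).topologicalClosure)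
    (hA_mal : ∀ x : G, x ∉ (Subgroup.zpowers (α e)).topologicalClosure →
      (Subgroup.zpowers (α e)).topologicalClosure ⊓
        ConjAct.toConjAct x • (Subgroup.zpowers (α e)).topologicalClosure = ⊥)
    (hB_mal : ∀ (k : ℕ) (x : G), x ∉ (Subgroup.zpowers (β k e)).topologicalClosure →
      (Subgroup.zpowers (β k e)).topologicalClosure ⊓
        ConjAct.toConjAct x • (Subgroup.zpowers (β k e)).topologicalClosure = ⊥)
    (hcross : ∀ (k : ℕ) (g : ConjAct G),
      (Subgroup.zpowers (α e)).topologicalClosure ⊓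
        g • (Subgroup.zpowers (β (k + 1) e)).topologicalClosure = ⊥) :
    (thetaRay G E α β).IsTotallyEstranged :=
  (thetaRay_isTotallyEstranged_and_isTotallyAloof_of_topologicalClosure α β e he hA_inf hB_inf hA_mal
    hB_mal hcross).1

/-- The `IsTotallyAloof` half (binder `hTA` of `thetaRay_prop36Hypotheses` / `thetaRay_thm37Hypotheses`).
[cite: MochizukiSemiAnbd2006, Def 2.4(iv) p.26] -/
theorem thetaRay_isTotallyAloof_of_topologicalClosure (e : E)
    (he : (Subgroup.zpowers e).topologicalClosure = ⊤)
    (hA_inf : Infinite (Subgroup.zpowers (α e)).topologicalClosure)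
    (hB_inf : ∀ k, Infinite (Subgroup.zpowers (β k e)).topologicalClosure)
    (hA_mal : ∀ x : G, x ∉ (Subgroup.zpowers (α e)).topologicalClosure →
      (Subgroup.zpowers (α e)).topologicalClosure ⊓
        ConjAct.toConjAct x • (Subgroup.zpowers (α e)).topologicalClosure = ⊥)
    (hB_mal : ∀ (k : ℕ) (x : G), x ∉ (Subgroup.zpowers (β k e)).topologicalClosure →
      (Subgroup.zpowers (β k e)).topologicalClosure ⊓
        ConjAct.toConjAct x • (Subgroup.zpowers (β k e)).topologicalClosure = ⊥)
    (hcross : ∀ (k : ℕ) (g : ConjAct G),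
      (Subgroup.zpowers (α e)).topologicalClosure ⊓
        g • (Subgroup.zpowers (β (k + 1) e)).topologicalClosure = ⊥) :
    (thetaRay G E α β).IsTotallyAloof :=
  (thetaRay_isTotallyEstranged_and_isTotallyAloof_of_topologicalClosure α β e he hA_inf hB_inf hA_mal
    hB_mal hcross).2

end Closure

/-! ### The memo's shape with twists `low k = θ_{n_k} ∘ α` -/

section Twists

variable {G E : Type} [Group G] [TopologicalSpace G] [IsTopologicalGroup G] [CompactSpace G]
  [TotallyDisconnectedSpace G] [T2Space G] [Group E] [TopologicalSpace E] [IsTopologicalGroup E]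
  [CompactSpace E] [TotallyDisconnectedSpace E] (α : E →ₜ* G) (θ : ℕ → (G →ₜ* G)) (n : ℕ → ℕ)

/-- **(H3) for `thetaRayOfTwists G E α θ n`** (memo §1: `a := α e`, lower gluings `θ_{n_k}(a)`), closure
spelling: infinitude and malnormality of `closure ⟨a⟩` and of every `closure ⟨θ_{n_k} a⟩`, and the cross terms
`closure ⟨a⟩ ∩ g • closure ⟨θ_{n_{k+1}} a⟩ = 1`, give total estrangement and total aloofness.
[cite: MochizukiSemiAnbd2006, Def 2.4(iv) p.26] -/
theorem thetaRayOfTwists_isTotallyEstranged_and_isTotallyAloof (e : E)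
    (he : (Subgroup.zpowers e).topologicalClosure = ⊤)
    (hA_inf : Infinite (Subgroup.zpowers (α e)).topologicalClosure)
    (hB_inf : ∀ k, Infinite (Subgroup.zpowers (θ (n k) (α e))).topologicalClosure)
    (hA_mal : ∀ x : G, x ∉ (Subgroup.zpowers (α e)).topologicalClosure →
      (Subgroup.zpowers (α e)).topologicalClosure ⊓
        ConjAct.toConjAct x • (Subgroup.zpowers (α e)).topologicalClosure = ⊥)
    (hB_mal : ∀ (k : ℕ) (x : G), x ∉ (Subgroup.zpowers (θ (n k) (α e))).topologicalClosure →
      (Subgroup.zpowers (θ (n k) (α e))).topologicalClosure ⊓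
        ConjAct.toConjAct x • (Subgroup.zpowers (θ (n k) (α e))).topologicalClosure = ⊥)
    (hcross : ∀ (k : ℕ) (g : ConjAct G),
      (Subgroup.zpowers (α e)).topologicalClosure ⊓
        g • (Subgroup.zpowers (θ (n (k + 1)) (α e))).topologicalClosure = ⊥) :
    (thetaRayOfTwists G E α θ n).IsTotallyEstranged ∧ (thetaRayOfTwists G E α θ n).IsTotallyAloof :=
  thetaRay_isTotallyEstranged_and_isTotallyAloof_of_topologicalClosure α (fun k => (θ (n k)).comp α) e he
    hA_inf hB_inf hA_mal hB_mal hcross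

end Twists

end ProfiniteSemiGraph

end Literature.AnabelianGeometry.SemiGraphs

end
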